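import Summits.BirchSwinnertonDyer.BirchSwinnertonDyer.Theorems.EisensteinPrimesGoodLatticeQuotCharUnramified
import Literature.NumberTheory.EllipticCurves.MazurTorsionGaloisStructureProofs
import HarnessLib

/-!
# Route `EisensteinPrimes` (rung K5), crux 2 `GoodLatticeBDPValue`, line `halves`: the residual
# pair of the good lattice has CYCLOTOMIC DETERMINANT — `ω̃ · 𝟙̃ = ω` (Teichmüller-lifted), in the kernel

Cell `bsd-eis`, seat `bsd-eis-k5-c2` (gen 7). Kernel input **(K-det)** of road R-ψ for the residue
[BRω] of `stub_muLambda` (HOME/k5-c2-MEMO-6.md ADDENDUM (2); HOME/k5-ty-g8/BR-OMEGA-ROAD.md §2 (a)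
"`φψ = ω̃ := Teichmüller ∘ (χ_cyc mod p)` on `Γ_ℚ` [det ρ̄_E = ω; KERNEL INPUT (K-det)]").

For an elliptic curve `E` over a perfect field `F`, a prime `N ≠ char F`, a `Γ_F`-stable line
`Φ ≤ E[N]` (`#Φ = N`) and the two characters of the exact sequence `0 → Φ → E[N] → E[N]/Φ → 0`
TEICHMÜLLER-LIFTED to `GL₁(𝓞)`, `𝓞 = 𝓞_{ℚ_p(S)} ⊂ ℚ̄_p` (the tree's predicates
`KellerYin2024.IsTeichmullerLiftOn` / `IsTeichmullerLiftOnQuot`, by which the typed statements of the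
line quantify over Keller–Yin's `ω̃ = φ` and `𝟙̃ = ψ`), the product of the two lifts is the
Teichmüller lift of the mod-`N` cyclotomic character:

  `θ_sub(σ) · θ_quot(σ) = ω(χ̄_N(σ))` in `ℚ̄_p`, for every `σ ∈ Γ_F`

(`ω = Kato2004.teichmullerChar`, `χ̄_N = modPCyclotomicCharacterZMod F N`). Proof: in a frame
`e : E[N] ≃ 𝔽_N²` through a generator `P` of `Φ` the matrix of `σ` is `(a b; 0 d)` with `σP = aP`,
`σS ≡ dS (mod Φ)`; **`det ρ̄_{E,N} = χ̄_N`** (Silverman, CSS Ch. II §7–§8, from the Weil pairing — tree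
`det_eq_modPCyclotomicCharacterZMod_of_exists_weilPairing` with the PROVED pairing
`exists_weilPairing_holds`) gives `ad = χ̄_N(σ)` in `𝔽_N`; the lifts are `(N−1)`-st roots of unity
congruent to `a`, `d`, `ω(χ̄_N(σ))` modulo the maximal ideal, and congruent `(N−1)`-st roots of unity
of `ℚ̄_p` are equal (`eq_one_of_pow_eq_one_of_norm_sub_one_lt_one`, Hensel).

* `det_eq_mul_of_smul_eq_of_smul_sub_mem` — the frame computation `a·d = χ̄_N(σ)` (Mazur's
  "`(1 *; 0 χ)`" display, tree `smul_sub_cyclotomic_smul_mem_zmultiples`, with `1` replaced by `a`).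
* `eq_zmultiples_of_card_eq`, `exists_eq_zsmul_of_mem_of_card_eq`, `exists_mem_geomTorsion_not_mem`,
  `exists_ne_zero_of_card_eq` — a subgroup of `E(F̄)` of prime order is the cyclic group on any of
  its non-zero elements, and `E[N]` is bigger (plumbing).
* `entry_mul_entry_eq_teichmullerChar` — **(K-det)**.

HONEST FRAMING: elementary, unconditional; closes nothing by itself (helper for
stmt-BirchSwinnertonDyer-19032, `--supports`). References: [SilvermanCSS1997] Ch. II §7 Prop.
(`det ρ̄_m = χ_m`), §8; [SilvermanAEC2009] III.8.1, III.6.4(b); [Mazur1977] Ch. III §5 (5.4);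
[KellerYin2024] §1.1 (L441), §1.4 (L1063–1086); [LangCyclotomic1990] Ch. 1 §2.
-/

set_option autoImplicit false
set_option linter.dupNamespace false

noncomputable section

open scoped Classical

open WeierstrassCurve NumberField IsDedekindDomain Field
  Literature.NumberTheory.EllipticCurves Literature.NumberTheory.GaloisRepresentations
  Literature.NumberTheory.EllipticCurves.KellerYin2024

namespace Summit.BirchSwinnertonDyer.BirchSwinnertonDyer.Theorems.EisensteinPrimesMuLambda

universe u

/-! ## §1 The frame computation: `a · d = χ̄_N(σ)` -/

section Frame

variable {F : Type u} [Field F] [PerfectField F] (W : WeierstrassCurve F) [W.IsElliptic]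
  (N : ℕ) [Fact N.Prime] [NeZero (N : F)]

/-- **`det ρ̄_{E,N} = χ̄_N` read on a stable line.** Let `P ∈ E[N] ∖ {O}`, `σ ∈ Γ_F` with `σP = aP`
(`a ∈ ℤ`), and `S ∈ E[N] ∖ ⟨P⟩` with `σS − dS ∈ ⟨P⟩` (`d ∈ ℤ`). Then `a·d = χ̄_N(σ)` in `ℤ/N`: in a
frame `e : E[N] ≃ 𝔽_N²` with `e P = (1, 0)` (`exists_addEquiv_apply_eq_single`) the matrix of `σ` is
`(a b; 0 d)` and its determinant is `χ̄_N(σ)` by the Weil pairing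
(`det_eq_modPCyclotomicCharacterZMod_of_exists_weilPairing`, `exists_weilPairing_holds`).
[cite: SilvermanCSS1997, Ch. II §7 Proposition (det ρ̄_m = χ_m) and §8]
[cite: Mazur1977, Ch. III §5, display after (5.4) (p. 157)] -/
theorem det_eq_mul_of_smul_eq_of_smul_sub_mem {P : geomTorsion W N} (hP0 : P ≠ 0)
    (σ : absoluteGaloisGroup F) {a : ℤ} (ha : σ • P = a • P) {S : geomTorsion W N}
    (hS : S ∉ AddSubgroup.zmultiples P) {d : ℤ} (hd : σ • S - d • S ∈ AddSubgroup.zmultiples P) :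
    ((a * d : ℤ) : ZMod N) = ((modPCyclotomicCharacterZMod F N σ : (ZMod N)ˣ) : ZMod N) := by
  letI : Module (ZMod N) (geomTorsion W N) := AddSubgroup.torsionBy.zmodModule
  haveI : NeZero N := ⟨(Fact.out : N.Prime).ne_zero⟩
  obtain ⟨e, heP⟩ := exists_addEquiv_apply_eq_single W N hP0
  -- the matrix of `σ` in the frame `e`
  set M : Matrix (Fin 2) (Fin 2) (ZMod N) :=
    Matrix.of fun i j ↦ e (σ • e.symm (Pi.single j 1)) i with hM
  have hMvec : ∀ T : geomTorsion W N, e (σ • T) = M.mulVec (e T) := by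
    let f : (Fin 2 → ZMod N) →ₗ[ZMod N] (Fin 2 → ZMod N) :=
      (e.toAddMonoidHom.comp ((DistribSMul.toAddMonoidHom (geomTorsion W N) σ).comp
        e.symm.toAddMonoidHom)).toZModLinearMap N
    have hf : ∀ v, f v = e (σ • e.symm v) := fun _ ↦ rfl
    have hfg : f = Matrix.mulVecLin M := by
      refine (Pi.basisFun (ZMod N) (Fin 2)).ext fun j ↦ ?_
      rw [Pi.basisFun_apply, hf, Matrix.mulVecLin_apply, Matrix.mulVec_single_one]
      funext i
      rw [hM, Matrix.col_apply, Matrix.of_apply]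
    intro T
    have h := congrArg (fun g : (Fin 2 → ZMod N) →ₗ[ZMod N] (Fin 2 → ZMod N) ↦ g (e T)) hfg
    simp only [hf, Matrix.mulVecLin_apply, AddEquiv.symm_apply_apply] at h
    exact h
  have hdet := det_eq_modPCyclotomicCharacterZMod_of_exists_weilPairing W N
    (exists_weilPairing_holds W N) e σ M hMvec
  -- the first column of `M` is `e (σ P) = e (a • P) = (a, 0)`
  have hcol : ∀ i, M i 0 = ((a : ZMod N) • (Pi.single (0 : Fin 2) (1 : ZMod N) : Fin 2 → ZMod N)) i := by
    intro i
    rw [hM, Matrix.of_apply, ← heP, e.symm_apply_apply, ha, map_zsmul, zsmul_eq_mul]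
    simp [Pi.smul_apply, smul_eq_mul]
  have h00 : M 0 0 = (a : ZMod N) := by rw [hcol]; simp
  have h10 : M 1 0 = 0 := by rw [hcol]; simp
  -- the second coordinate of `e S` is non-zero (`S ∉ ⟨P⟩`)
  have hS1 : e S 1 ≠ 0 := by
    intro h0
    apply hS
    refine AddSubgroup.mem_zmultiples_iff.mpr ⟨((e S 0).val : ℤ), e.injective ?_⟩
    rw [map_zsmul, heP, natCast_zsmul]
    funext i
    fin_cases i
    · simp [Pi.smul_apply, nsmul_eq_mul]
    · simp [Pi.smul_apply, h0]
  -- `σ S − d S ∈ ⟨P⟩` has vanishing second coordinate: `M 1 1 = d`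
  have h11 : M 1 1 = (d : ZMod N) := by
    obtain ⟨k, hk⟩ := AddSubgroup.mem_zmultiples_iff.mp hd
    have h := congrArg (fun T : geomTorsion W N ↦ e T 1) hk
    simp only [map_zsmul, map_sub, heP, hMvec, Pi.smul_apply, Pi.sub_apply, zsmul_eq_mul,
      Matrix.mulVec, dotProduct, Fin.sum_univ_two, h10, zero_mul, zero_add, Pi.mul_apply,
      Pi.intCast_apply] at h
    -- `h : k * single 0 1 1 = M 1 1 * e S 1 - d * e S 1`
    have h' : (M 1 1 - (d : ZMod N)) * e S 1 = 0 := by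
      rw [sub_mul, ← h]
      simp
    rcases mul_eq_zero.mp h' with h1 | h1
    · exact (sub_eq_zero.mp h1)
    · exact absurd h1 hS1
  rw [Matrix.det_fin_two, h00, h10, h11, mul_zero, sub_zero] at hdet
  rw [← hdet, Int.cast_mul]

end Frame

/-! ## §2 Plumbing: a subgroup of prime order is cyclic on any non-zero element -/

section Cyclic

variable {F : Type u} [Field F] (W : WeierstrassCurve F) {N : ℕ} [hN : Fact N.Prime]

/-- A subgroup `Φ ≤ E[N]` of (prime) order `N` is generated by any of its non-zero elements:
`Φ = ⟨P⟩`. [folklore] -/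
theorem eq_zmultiples_of_card_eq {Φ : AddSubgroup (geomPoints W)} (hcard : Nat.card Φ = N)
    (hle : Φ ≤ geomTorsion W (N : ℤ)) {P : geomPoints W} (hP : P ∈ Φ) (hP0 : P ≠ 0) :
    Φ = AddSubgroup.zmultiples P := by
  have hfin : Finite Φ := Nat.finite_of_card_ne_zero (by rw [hcard]; exact hN.out.ne_zero)
  have hord : addOrderOf P = N := by
    have hNP : (N : ℤ) • P = 0 := (mem_geomTorsion_iff W (N : ℤ) P).mp (hle hP)
    rw [natCast_zsmul] at hNP
    rcases (Nat.dvd_prime hN.out).mp (addOrderOf_dvd_of_nsmul_eq_zero hNP) with h1 | h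
    · exact absurd (AddMonoid.addOrderOf_eq_one_iff.mp h1) hP0
    · exact h
  symm
  refine AddSubgroup.eq_of_le_of_card_ge (AddSubgroup.zmultiples_le.mpr hP) ?_
  rw [hcard, Nat.card_zmultiples, hord]

/-- Hence every element of such a `Φ` is an integer multiple of `P`. [folklore] -/
theorem exists_eq_zsmul_of_mem_of_card_eq {Φ : AddSubgroup (geomPoints W)} (hcard : Nat.card Φ = N)
    (hle : Φ ≤ geomTorsion W (N : ℤ)) {P : geomPoints W} (hP : P ∈ Φ) (hP0 : P ≠ 0)
    {R : geomPoints W} (hR : R ∈ Φ) : ∃ k : ℤ, k • P = R := by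
  rw [eq_zmultiples_of_card_eq W hcard hle hP hP0] at hR
  exact AddSubgroup.mem_zmultiples_iff.mp hR

/-- `E[N](F̄)` is strictly bigger than any subgroup of order `N` (`#E[N] = N²`; the tree's
`exists_mem_geomTorsion_notMem` for a general perfect base). [cite: SilvermanAEC2009, Cor. III.6.4(b)] -/
theorem exists_mem_geomTorsion_not_mem [W.IsElliptic] [NeZero (N : F)] {Φ : AddSubgroup (geomPoints W)}
    (hcard : Nat.card Φ = N) : ∃ P ∈ geomTorsion W (N : ℤ), P ∉ Φ := by
  by_contra h
  push Not at h
  have hle : geomTorsion W (N : ℤ) ≤ Φ := fun P hP ↦ h P hP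
  have hT : Nat.card (geomTorsion W (N : ℤ)) = N ^ 2 :=
    Literature.NumberTheory.EllipticCurves.natCard_geomTorsion W N
  have hfin : Finite Φ := Nat.finite_of_card_ne_zero (by rw [hcard]; exact hN.out.ne_zero)
  have hdvd : Nat.card (geomTorsion W (N : ℤ)) ∣ Nat.card Φ := AddSubgroup.card_dvd_of_le hle
  rw [hT, hcard, sq] at hdvd
  have := Nat.le_of_dvd hN.out.pos hdvd
  have h1 := hN.out.one_lt
  nlinarith

/-- A subgroup of prime order has a non-zero element. [folklore] -/
theorem exists_ne_zero_of_card_eq {Φ : AddSubgroup (geomPoints W)} (hcard : Nat.card Φ = N) :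
    ∃ P ∈ Φ, P ≠ 0 := by
  by_contra h
  push Not at h
  have hbot : Φ = ⊥ := (AddSubgroup.eq_bot_iff_forall _).mpr h
  rw [hbot, AddSubgroup.card_bot] at hcard
  exact hN.out.one_lt.ne hcard

end Cyclic

/-! ## §3 (K-det): `θ_sub · θ_quot = ω ∘ χ̄_N` for the Teichmüller-lifted residual pair -/

section Det

variable {F : Type} [Field F] [PerfectField F] (W : WeierstrassCurve F) [W.IsElliptic]
  {p : ℕ} [hp : Fact p.Prime] [NeZero (p : F)] (S : Set (PadicAlgCl p))

/-- `‖x‖ = 1` for the image in `ℚ̄_p` of a `(p−1)`-st root of unity of `ℤ_p` such as `ω(a)`. [folklore] -/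
theorem norm_algebraMap_teichmullerChar (a : (ZMod p)ˣ) :
    ‖algebraMap ℚ_[p] (PadicAlgCl p)
        (((Kato2004.teichmullerChar p a : ℤ_[p]ˣ) : ℤ_[p]) : ℚ_[p])‖ = 1 := by
  apply norm_eq_one_of_pow_sub_one_eq_one (p := p)
  rw [← map_pow, ← PadicInt.coe_pow, ← Units.val_pow_eq_pow_val, Kato2004.teichmullerChar_pow_sub_one,
    Units.val_one, PadicInt.coe_one, map_one]

/-- `‖ω(a) − ã‖ < 1` in `ℚ̄_p` for the integer lift `ã = a.val` (`ω(a) ≡ a (mod p)`).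
[cite: LangCyclotomic1990, Ch. 1 §2] -/
theorem norm_algebraMap_teichmullerChar_sub_natCast_lt_one (a : (ZMod p)ˣ) :
    ‖algebraMap ℚ_[p] (PadicAlgCl p)
        (((Kato2004.teichmullerChar p a : ℤ_[p]ˣ) : ℤ_[p]) : ℚ_[p]) -
      (((a : ZMod p).val : ℕ) : PadicAlgCl p)‖ < 1 := by
  have h := norm_teichmullerChar_sub_val_lt_one (p := p) a
  rw [show (((a : ZMod p).val : ℕ) : PadicAlgCl p) =
      algebraMap ℚ_[p] (PadicAlgCl p) ((((a : ZMod p).val : ℕ) : ℤ_[p]) : ℚ_[p]) by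
        rw [PadicInt.coe_natCast, map_natCast],
    ← map_sub, norm_algebraMap', ← PadicInt.coe_sub, ← PadicInt.norm_def]
  exact h

/-- **(K-det) — the residual pair of a stable line has cyclotomic determinant, Teichmüller-lifted.**
`E/F` elliptic over a perfect field, `p ≠ char F` prime, `Φ ≤ E[p]` a subgroup of order `p`
(automatically `Γ_F`-stable here: the predicates say `Γ_F` acts on `Φ` by scalars), `θ_sub`,
`θ_quot : Γ_F → GL₁(𝓞)` the Teichmüller lifts of the characters of `Γ_F` on `Φ` and on `E[p]/Φ`
(`IsTeichmullerLiftOn S Φ θ_sub`, `IsTeichmullerLiftOnQuot S Φ E[p] θ_quot`). Then for every `σ`,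
`θ_sub(σ) · θ_quot(σ) = ω(χ̄_p(σ))` in `ℚ̄_p` — Keller–Yin's `φψ = ω` (§1.1: "`E[p]^{ss} = 𝔽(φ) ⊕ 𝔽(ψ)`
… `φψ = ω`"), CGLS §1.1, read through the Teichmüller lift. Proof: §1 gives `a·d = χ̄_p(σ)` in `𝔽_p`
for the scalars `a ≡ θ_sub(σ)`, `d ≡ θ_quot(σ)`; both sides of the claim are `(p−1)`-st roots of unity
of `ℚ̄_p` congruent modulo the maximal ideal, hence equal (`eq_one_of_pow_eq_one_of_norm_sub_one_lt_one`).
[cite: KellerYin2024, §1.1 (arXiv:2402.12781v2 TeX L441–L450: "φψ = ω") and §1.4 (L1063–1086)]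
[cite: SilvermanCSS1997, Ch. II §7 Proposition (det ρ̄_m = χ_m) and §8]
[cite: LangCyclotomic1990, Ch. 1 §2 (uniqueness of the Teichmüller representative)] -/
theorem entry_mul_entry_eq_teichmullerChar {Φ : AddSubgroup (geomPoints W)} (hcard : Nat.card Φ = p)
    (hle : Φ ≤ geomTorsion W (p : ℤ))
    {θsub θquot : FramedGaloisRep F (padicCoeffIntegers S) 1}
    (hsub : IsTeichmullerLiftOn S Φ θsub) (hquot : IsTeichmullerLiftOnQuot S Φ (geomTorsion W (p : ℤ)) θquot)
    (σ : absoluteGaloisGroup F) :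
    ((entry S θsub σ : padicCoeffIntegers S) : PadicAlgCl p) *
        ((entry S θquot σ : padicCoeffIntegers S) : PadicAlgCl p) =
      algebraMap ℚ_[p] (PadicAlgCl p)
        (((Kato2004.teichmullerChar p (modPCyclotomicCharacterZMod F p σ) : ℤ_[p]ˣ) : ℤ_[p]) : ℚ_[p]) := by
  -- a generator `P₀` of `Φ` and a torsion point `S₀` outside `Φ`
  obtain ⟨P₀, hP₀, hP₀0⟩ := exists_ne_zero_of_card_eq W (N := p) hcard
  obtain ⟨S₀, hS₀, hS₀Φ⟩ := exists_mem_geomTorsion_not_mem W (N := p) hcard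
  -- the scalars `a`, `d`
  obtain ⟨a, ha, haΦ⟩ := hsub.exists_smul_eq σ
  obtain ⟨d, hd, hdΦ⟩ := hquot.2 σ
  -- in `E[p]` as a subtype
  set P : geomTorsion W (p : ℤ) := ⟨P₀, hle hP₀⟩ with hPdef
  set T : geomTorsion W (p : ℤ) := ⟨S₀, hS₀⟩ with hTdef
  have hP0 : P ≠ 0 := fun h ↦ hP₀0 (congrArg Subtype.val h)
  have haP : σ • P = a • P := Subtype.ext (by
    simp only [hPdef, AddSubgroup.torsionBy.coe_smul]
    exact haΦ P₀ hP₀)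
  have hTP : T ∉ AddSubgroup.zmultiples P := by
    intro h
    obtain ⟨k, hk⟩ := AddSubgroup.mem_zmultiples_iff.mp h
    apply hS₀Φ
    have h' : k • P₀ = S₀ := by
      have := congrArg Subtype.val hk
      simpa [hPdef, hTdef] using this
    rw [← h']
    exact Φ.zsmul_mem hP₀ k
  have hdT : σ • T - d • T ∈ AddSubgroup.zmultiples P := by
    obtain ⟨k, hk⟩ := exists_eq_zsmul_of_mem_of_card_eq W hcard hle hP₀ hP₀0 (hdΦ S₀ hS₀)
    refine AddSubgroup.mem_zmultiples_iff.mpr ⟨k, Subtype.ext ?_⟩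
    simp only [hPdef, hTdef, AddSubgroupClass.coe_sub, AddSubgroup.torsionBy.coe_smul]
    exact hk
  -- §1: `a·d = χ̄_p(σ)` in `𝔽_p`
  have hdet := det_eq_mul_of_smul_eq_of_smul_sub_mem W p hP0 σ haP hTP hdT
  -- the congruences in `ℚ̄_p`
  set χ : (ZMod p)ˣ := modPCyclotomicCharacterZMod F p σ with hχ
  set x : PadicAlgCl p := ((entry S θsub σ : padicCoeffIntegers S) : PadicAlgCl p) with hx
  set y : PadicAlgCl p := ((entry S θquot σ : padicCoeffIntegers S) : PadicAlgCl p) with hy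
  set t : PadicAlgCl p := algebraMap ℚ_[p] (PadicAlgCl p)
    (((Kato2004.teichmullerChar p χ : ℤ_[p]ˣ) : ℤ_[p]) : ℚ_[p]) with ht
  have hxpow : x ^ (p - 1) = 1 := by
    have h := congrArg ((↑) : padicCoeffIntegers S → PadicAlgCl p)
      (entry_pow_eq_one_of_pow_eq_one S θsub σ (hsub.1 σ))
    push_cast at h
    exact h
  have hypow : y ^ (p - 1) = 1 := by
    have h := congrArg ((↑) : padicCoeffIntegers S → PadicAlgCl p)
      (entry_pow_eq_one_of_pow_eq_one S θquot σ (hquot.1 σ))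
    push_cast at h
    exact h
  have htpow : t ^ (p - 1) = 1 := by
    rw [ht, ← map_pow, ← PadicInt.coe_pow, ← Units.val_pow_eq_pow_val,
      Kato2004.teichmullerChar_pow_sub_one, Units.val_one, PadicInt.coe_one, map_one]
  have hxn : ‖x‖ = 1 := norm_eq_one_of_pow_sub_one_eq_one hxpow
  have htn : ‖t‖ = 1 := norm_algebraMap_teichmullerChar (p := p) χ
  have ht0 : t ≠ 0 := fun h ↦ by rw [h, norm_zero] at htn; exact zero_ne_one htn
  -- `‖xy − ad‖ < 1`
  have hdn : ‖(d : PadicAlgCl p)‖ ≤ 1 := by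
    rw [show (d : PadicAlgCl p) = (((d : ℤ_[p]) : ℚ_[p]) : PadicAlgCl p) by push_cast; rfl,
      PadicAlgCl.norm_extends]
    exact PadicInt.norm_le_one _
  have h1 : ‖x * y - (a : PadicAlgCl p) * (d : PadicAlgCl p)‖ < 1 := by
    have e : x * y - (a : PadicAlgCl p) * (d : PadicAlgCl p) =
        x * (y - (d : PadicAlgCl p)) + (d : PadicAlgCl p) * (x - (a : PadicAlgCl p)) := by ring
    rw [e]
    refine (IsUltrametricDist.norm_add_le_max _ _).trans_lt (max_lt ?_ ?_)
    · rw [norm_mul, hxn, one_mul]; exact hd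
    · rw [norm_mul]
      calc ‖(d : PadicAlgCl p)‖ * ‖x - (a : PadicAlgCl p)‖ ≤ 1 * ‖x - (a : PadicAlgCl p)‖ := by
            gcongr
        _ < 1 := by rw [one_mul]; exact ha
  -- `‖ad − χ.val‖ < 1`
  have h2 : ‖(a : PadicAlgCl p) * (d : PadicAlgCl p) - (((χ : ZMod p).val : ℕ) : PadicAlgCl p)‖ < 1 := by
    have hdvd : (p : ℤ) ∣ a * d - ((χ : ZMod p).val : ℕ) := by
      rw [← ZMod.intCast_zmod_eq_zero_iff_dvd]
      push_cast
      rw [Int.cast_mul] at hdet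
      rw [hdet, ZMod.natCast_zmod_val, sub_self]
    rw [show (a : PadicAlgCl p) * (d : PadicAlgCl p) - (((χ : ZMod p).val : ℕ) : PadicAlgCl p) =
        (((a * d - ((χ : ZMod p).val : ℕ) : ℤ) : ℚ_[p]) : PadicAlgCl p) by push_cast; rfl,
      PadicAlgCl.norm_extends]
    exact Padic.norm_intCast_lt_one_iff.mpr hdvd
  -- `‖χ.val − t‖ < 1`
  have h3 : ‖(((χ : ZMod p).val : ℕ) : PadicAlgCl p) - t‖ < 1 := by
    rw [← norm_neg, neg_sub]
    exact norm_algebraMap_teichmullerChar_sub_natCast_lt_one (p := p) χ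
  have hxyt : ‖x * y - t‖ < 1 := by
    have e : x * y - t = (x * y - (a : PadicAlgCl p) * (d : PadicAlgCl p)) +
        (((a : PadicAlgCl p) * (d : PadicAlgCl p) - (((χ : ZMod p).val : ℕ) : PadicAlgCl p)) +
          ((((χ : ZMod p).val : ℕ) : PadicAlgCl p) - t)) := by ring
    rw [e]
    refine (IsUltrametricDist.norm_add_le_max _ _).trans_lt (max_lt h1 ?_)
    exact (IsUltrametricDist.norm_add_le_max _ _).trans_lt (max_lt h2 h3)
  -- `z = xy·t⁻¹` is a `(p−1)`-st root of unity congruent to `1`, hence `1`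
  have hz : x * y * t⁻¹ = 1 := by
    apply eq_one_of_pow_eq_one_of_norm_sub_one_lt_one (p := p)
    · rw [mul_pow, mul_pow, hxpow, hypow, inv_pow, htpow, inv_one, one_mul, one_mul]
    · have e : x * y * t⁻¹ - 1 = (x * y - t) * t⁻¹ := by field_simp
      rw [e, norm_mul, norm_inv, htn, inv_one, mul_one]
      exact hxyt
  calc x * y = x * y * t⁻¹ * t := by field_simp
    _ = t := by rw [hz, one_mul]

end Det

end Summit.BirchSwinnertonDyer.BirchSwinnertonDyer.Theorems.EisensteinPrimesMuLambda

end
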